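import Summits.QuantumFields.YangMills.Theorems.AllWindowsColdBoxBoxHighLineSmearedFPPauli
import Summits.QuantumFields.YangMills.Theorems.AllWindowsColdBoxBoxHighLineHaarDensityFlat
import Summits.QuantumFields.YangMills.Theorems.LuscherReductionTwistedTraceScalingGaussianPi
import Literature.MathematicalPhysics.QuantumFieldTheory.Balaban1983to89.B10Eq18ChangeOfVariables
import Summits.QuantumFields.YangMills.Theorems.BalabanUVNodesN08HaarCompatibilityGuardCoerciveWindows

/-!
# Laplace SANDWICH for the orbit average `N_h` — part (4k-C): the orbit integral in FLAT Pauli coordinates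
# `v : interiorSites H × Fin 3 → ℝ` with an explicit product density, and the density bounds that feed the sandwich
# (T-S5.4 of `Cruxes/BoxWindowHighSU2213/STUB-PLAN-S5U5-STEP1b.md`; seat ym-line-fcl-p3 g25)

4b (✓`orbitAveragePauli`) writes `N_h(U) = ∫ A : I → ℝ³, h(U^{pauliGauge A}) dΠσ`; the tree's ✓`pi_sigmaMeasure_eq`
(`B10Eq18ChangeOfVariables`) says `Πσ = 1_{Π balls}·Π_x σ_{SU(2)}(‖A_x‖) · Lebesgue`; flattening `(I → ℝ³) ≃ᵐ (I × Fin 3 → ℝ)` is volume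
preserving (Mathlib `volume_preserving_pi` + RED's ✓`volume_preserving_uncurry`).  Hence (§2)
`orbitAverage H h U = ∫ v : I × Fin 3 → ℝ, pauliDensity (♭⁻¹ v) · h(U^{pauliGauge (♭⁻¹ v)}) dv` — the integrand `Ψ` of 4k-B
`laplace_sandwich_upper/lower` on `ι = I × Fin 3`, where the Faddeev–Popov matrix `fpOperator H U` (4c) lives.  §3 gives the density bounds
the sandwich consumes: `0 ≤ pauliDensity ≤ (2π²)^{−|I|}` everywhere and, on `{∀ x, ‖A_x‖ ≤ 1}`,
`e^{−Σ_x(‖A_x‖²/3 + ‖A_x‖⁴)} ≤ (2π²)^{|I|}·pauliDensity A ≤ e^{−Σ_x(‖A_x‖²/3 − ‖A_x‖⁴)}` (4d ✓`haarDensityFlat_one`), with `Σ_x ‖A_x‖² = v ⬝ᵥ v`.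

HONEST LABEL: transport/bookkeeping for step (1b) of the XL stubs S5 (LINE-19 ⟨stmt-QuantumFields-24004⟩/⟨24335⟩) / U5 (LINE-20 ⟨24336⟩);
T-S5.4 proper, S5, U5 and the three items are OPEN; the Yang–Mills mass gap is NOT proved by this file; no summit is proved by a line.
-/

set_option autoImplicit false

noncomputable section

open MeasureTheory Matrix Real Metric
open Literature.MathematicalPhysics.QuantumFieldTheory
open Literature.MathematicalPhysics.QuantumFieldTheory.Balaban1983to89
open Literature.MathematicalPhysics.QuantumFieldTheory.Balaban1983to89.B10Eq18SigmaSU2Haar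
open Literature.MathematicalPhysics.QuantumFieldTheory.Balaban1983to89.B10Eq22Rescaling
open Literature.MathematicalPhysics.QuantumLattice

namespace Summit.QuantumFields.YangMills.Theorems.AllWindowsColdBoxBoxHighLine.LaplaceSandwich

variable (I : Type) [Fintype I]

/-! ## §1 Flattening `(I → ℝ³) ≃ᵐ (I × Fin 3 → ℝ)` is volume preserving -/

/-- The flattening of Pauli coordinates: `A : I → ℝ³` ↦ `v (x, c) = (A x) c`. [folklore] -/
def flatten : (I → EuclideanSpace ℝ (Fin 3)) ≃ᵐ (I × Fin 3 → ℝ) :=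
  (MeasurableEquiv.piCongrRight fun _ : I => (MeasurableEquiv.toLp 2 (Fin 3 → ℝ)).symm).trans
    (MeasurableEquiv.curry I (Fin 3) ℝ).symm

omit [Fintype I] in
/-- Action of the flattening. [folklore] -/
@[simp] theorem flatten_apply (A : I → EuclideanSpace ℝ (Fin 3)) (x : I) (c : Fin 3) : flatten I A (x, c) = A x c := rfl

omit [Fintype I] in
/-- Action of the inverse flattening. [folklore] -/
@[simp] theorem flatten_symm_apply (v : I × Fin 3 → ℝ) (x : I) (c : Fin 3) : (flatten I).symm v x c = v (x, c) := rfl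

/-- ★ Flattening preserves Lebesgue measure. [folklore] -/
theorem volume_preserving_flatten : MeasurePreserving (flatten I) := by
  have h1 : MeasurePreserving (fun (A : I → EuclideanSpace ℝ (Fin 3)) (x : I) => (MeasurableEquiv.toLp 2 (Fin 3 → ℝ)).symm (A x)) :=
    volume_preserving_pi fun _ : I => EuclideanSpace.volume_preserving_symm_measurableEquiv_toLp (Fin 3)
  exact (FemtoTransferGap.TwoLattice.ConstTube.volume_preserving_uncurry I (Fin 3)).comp h1

omit [Fintype I] in
/-- The squared Euclidean norm of a site variable is the sum of squares of its three flat coordinates. [folklore] -/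
theorem norm_sq_eq_sum (A : I → EuclideanSpace ℝ (Fin 3)) (x : I) : ‖A x‖ ^ 2 = ∑ c, (flatten I A (x, c)) ^ 2 := by
  rw [EuclideanSpace.norm_sq_eq]
  simp only [Real.norm_eq_abs, sq_abs, flatten_apply]

/-- ★ `Σ_x ‖A_x‖² = v ⬝ᵥ v` for `v = ♭A`. [folklore] -/
theorem sum_norm_sq_eq_dotProduct (A : I → EuclideanSpace ℝ (Fin 3)) : ∑ x, ‖A x‖ ^ 2 = flatten I A ⬝ᵥ flatten I A := by
  simp only [norm_sq_eq_sum, dotProduct, ← sq]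
  rw [← Finset.sum_product', Finset.univ_product_univ]

omit [Fintype I] in
/-- A flat coordinate is bounded by the site norm: `|v(x,c)| ≤ ‖A_x‖`. [folklore] -/
theorem abs_flatten_le_norm (A : I → EuclideanSpace ℝ (Fin 3)) (x : I) (c : Fin 3) : |flatten I A (x, c)| ≤ ‖A x‖ := by
  rw [flatten_apply, ← Real.norm_eq_abs]
  exact PiLp.norm_apply_le (A x) c

omit [Fintype I] in
/-- The site norm is bounded by `√3` times the largest flat coordinate: `‖A_x‖² ≤ 3 ρ²` if `|v(x,c)| ≤ ρ` for all `c`. [folklore] -/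
theorem norm_sq_le_three_mul_sq {A : I → EuclideanSpace ℝ (Fin 3)} {x : I} {ρ : ℝ} (h : ∀ c, |flatten I A (x, c)| ≤ ρ) :
    ‖A x‖ ^ 2 ≤ 3 * ρ ^ 2 := by
  rw [norm_sq_eq_sum]
  calc ∑ c, flatten I A (x, c) ^ 2 ≤ ∑ _c : Fin 3, ρ ^ 2 := Finset.sum_le_sum fun c _ => by
          rw [← sq_abs]; exact pow_le_pow_left₀ (abs_nonneg _) (h c) 2
    _ = 3 * ρ ^ 2 := by simp

/-! ## §2 The orbit integral in flat coordinates -/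

/-- The product density of Pauli coordinates (Haar of `SU(2)^I` in the exponential chart, carried by the product of injectivity balls):
`pauliDensity A = 1_{∀x, ‖A_x‖ < π} · Π_x σ_{SU(2)}(‖A_x‖)`. [folklore] -/
def pauliDensity (A : I → EuclideanSpace ℝ (Fin 3)) : ℝ :=
  (Set.pi Set.univ fun _ : I => ball (0 : EuclideanSpace ℝ (Fin 3)) Real.pi).indicator (fun A => ∏ x, sigmaSU2 ‖A x‖) A

/-- `σ_{SU(2)} ≥ 0`. [folklore] -/
theorem sigmaSU2_nonneg (r : ℝ) : 0 ≤ sigmaSU2 r := by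
  unfold sigmaSU2; positivity

/-- `0 ≤ pauliDensity ≤ (2π²)^{−|I|}`. [folklore] -/
theorem pauliDensity_nonneg_le (A : I → EuclideanSpace ℝ (Fin 3)) :
    0 ≤ pauliDensity I A ∧ pauliDensity I A ≤ (1 / (2 * Real.pi ^ 2)) ^ Fintype.card I := by
  unfold pauliDensity
  by_cases hA : A ∈ Set.pi Set.univ fun _ : I => ball (0 : EuclideanSpace ℝ (Fin 3)) Real.pi
  · rw [Set.indicator_of_mem hA]
    refine ⟨Finset.prod_nonneg fun x _ => sigmaSU2_nonneg _, ?_⟩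
    calc ∏ x, sigmaSU2 ‖A x‖ ≤ ∏ _x : I, 1 / (2 * Real.pi ^ 2) :=
          Finset.prod_le_prod (fun x _ => sigmaSU2_nonneg _) fun x _ => BalabanUVNodes.N08HaarCompatibilityGuardCoerciveWindows.sigmaSU2_le_sigma0 _
      _ = (1 / (2 * Real.pi ^ 2)) ^ Fintype.card I := by rw [Finset.prod_const, Finset.card_univ]
  · rw [Set.indicator_of_notMem hA]
    exact ⟨le_rfl, by positivity⟩

/-- ★ **`∫ G dΠσ = ∫ pauliDensity · G dA`** (Bochner; from the tree's ✓`pi_sigmaMeasure_eq`). [folklore] -/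
theorem integral_pi_sigmaMeasure_eq_integral_mul (G : (I → EuclideanSpace ℝ (Fin 3)) → ℝ) :
    ∫ A, G A ∂(Measure.pi fun _ : I => sigmaMeasure) = ∫ A, pauliDensity I A * G A := by
  have hmeas : Measurable fun A : I → EuclideanSpace ℝ (Fin 3) => ∏ x, ENNReal.ofReal (sigmaSU2 ‖A x‖) :=
    Finset.measurable_prod _ fun x _ => (measurable_sigmaSU2_norm.comp (measurable_pi_apply x)).ennreal_ofReal
  rw [B10Eq18ChangeOfVariables.pi_sigmaMeasure_eq, integral_withDensity_eq_integral_toReal_smul hmeas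
    (Filter.Eventually.of_forall fun A => ENNReal.prod_lt_top fun x _ => ENNReal.ofReal_lt_top), ← integral_indicator
    (MeasurableSet.univ_pi fun _ => measurableSet_ball)]
  refine integral_congr_ae (ae_of_all _ fun A => ?_)
  dsimp only
  unfold pauliDensity
  by_cases hA : A ∈ Set.pi Set.univ fun _ : I => ball (0 : EuclideanSpace ℝ (Fin 3)) Real.pi
  · rw [Set.indicator_of_mem hA, Set.indicator_of_mem hA, smul_eq_mul, ENNReal.toReal_prod]
    congr 1
    exact Finset.prod_congr rfl fun x _ => ENNReal.toReal_ofReal (sigmaSU2_nonneg _)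
  · rw [Set.indicator_of_notMem hA, Set.indicator_of_notMem hA, zero_mul]

/-- ★ **The same in flat coordinates**: `∫ G dΠσ = ∫ v : I × Fin 3 → ℝ, pauliDensity(♭⁻¹v) · G(♭⁻¹v) dv`. [folklore] -/
theorem integral_pi_sigmaMeasure_eq_flat (G : (I → EuclideanSpace ℝ (Fin 3)) → ℝ) :
    ∫ A, G A ∂(Measure.pi fun _ : I => sigmaMeasure) =
      ∫ v : I × Fin 3 → ℝ, pauliDensity I ((flatten I).symm v) * G ((flatten I).symm v) := by
  rw [integral_pi_sigmaMeasure_eq_integral_mul,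
    ← ((volume_preserving_flatten I).symm _).integral_comp' (f := (flatten I).symm)
      (g := fun A => pauliDensity I A * G A)]

/-- ★★ **THE ORBIT AVERAGE IN FLAT PAULI COORDINATES**: for measurable `h`,
`orbitAverage H h U = ∫ v : interiorSites H × Fin 3 → ℝ, pauliDensity(♭⁻¹v) · h(U^{pauliGauge H (♭⁻¹v)}) dv` — the integrand `Ψ` of 4k-B
`laplace_sandwich_upper/lower` on `ι = interiorSites H × Fin 3`. [folklore] -/
theorem orbitAverage_eq_flat (H : ℕ) {h : LGConfig 4 SU2 → ℝ} (hm : Measurable h) (U : LGConfig 4 SU2) :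
    orbitAverage H h U =
      ∫ v : ↥(interiorSites H) × Fin 3 → ℝ,
        pauliDensity ↥(interiorSites H) ((flatten ↥(interiorSites H)).symm v) *
          h (gaugeTransformZd (pauliGauge H ((flatten ↥(interiorSites H)).symm v)) U) := by
  rw [orbitAveragePauli H h hm U]
  exact integral_pi_sigmaMeasure_eq_flat _ _

/-! ## §3 Density bounds on the unit box (input to the bulk hypotheses of the sandwich) -/

/-- Two-sided exponential bounds for one factor on `|t| ≤ 1`: `e^{−t²/3 − t⁴} ≤ 2π² σ_{SU(2)}(t) ≤ e^{−t²/3 + t⁴}` (4d ✓`haarDensityFlat_one`). [folklore] -/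
theorem exp_le_two_pi_sq_mul_sigmaSU2_le {t : ℝ} (ht : |t| ≤ 1) :
    Real.exp (-(t ^ 2 / 3) - t ^ 4) ≤ 2 * Real.pi ^ 2 * sigmaSU2 t ∧
      2 * Real.pi ^ 2 * sigmaSU2 t ≤ Real.exp (-(t ^ 2 / 3) + t ^ 4) := by
  have h := abs_le.1 (haarDensityFlat_one ht)
  have hpos : 0 < 2 * Real.pi ^ 2 * sigmaSU2 t := by
    have hπ : |t| < Real.pi := lt_of_le_of_lt ht (by linarith [Real.pi_gt_three])
    have := sigmaSU2_pos (abs_nonneg t) hπ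
    have habs : sigmaSU2 |t| = sigmaSU2 t := by
      unfold sigmaSU2
      rcases le_or_gt 0 t with h0 | h0
      · rw [abs_of_nonneg h0]
      · rw [abs_of_neg h0, Real.sin_neg, neg_div_neg_eq]; simp [h0.ne]
    rw [habs] at this
    positivity
  constructor
  · calc Real.exp (-(t ^ 2 / 3) - t ^ 4) ≤ Real.exp (Real.log (2 * Real.pi ^ 2 * sigmaSU2 t)) :=
          Real.exp_le_exp.2 (by linarith [h.1])
      _ = 2 * Real.pi ^ 2 * sigmaSU2 t := Real.exp_log hpos
  · calc 2 * Real.pi ^ 2 * sigmaSU2 t = Real.exp (Real.log (2 * Real.pi ^ 2 * sigmaSU2 t)) := (Real.exp_log hpos).symm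
      _ ≤ Real.exp (-(t ^ 2 / 3) + t ^ 4) := Real.exp_le_exp.2 (by linarith [h.2])

/-- On the unit box `{∀ x, ‖A_x‖ ≤ 1}` the configuration lies in the product of injectivity balls, so the indicator in `pauliDensity` is `1`. [folklore] -/
theorem pauliDensity_eq_prod {A : I → EuclideanSpace ℝ (Fin 3)} (hA : ∀ x, ‖A x‖ ≤ 1) :
    pauliDensity I A = ∏ x, sigmaSU2 ‖A x‖ := by
  unfold pauliDensity
  rw [Set.indicator_of_mem]
  intro x _
  rw [mem_ball_zero_iff]
  linarith [hA x, Real.pi_gt_three]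

/-- ★ **Two-sided Haar-density bounds on the unit box**: if `‖A_x‖ ≤ 1` for all `x` then
`e^{−Σ_x(‖A_x‖²/3 + ‖A_x‖⁴)} ≤ (2π²)^{|I|} · pauliDensity A ≤ e^{−Σ_x(‖A_x‖²/3 − ‖A_x‖⁴)}`. [folklore] -/
theorem pauliDensity_two_sided {A : I → EuclideanSpace ℝ (Fin 3)} (hA : ∀ x, ‖A x‖ ≤ 1) :
    Real.exp (-(∑ x, (‖A x‖ ^ 2 / 3 + ‖A x‖ ^ 4))) ≤ (2 * Real.pi ^ 2) ^ Fintype.card I * pauliDensity I A ∧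
      (2 * Real.pi ^ 2) ^ Fintype.card I * pauliDensity I A ≤ Real.exp (-(∑ x, (‖A x‖ ^ 2 / 3 - ‖A x‖ ^ 4))) := by
  have hx : ∀ x, |‖A x‖| ≤ 1 := fun x => by rw [abs_of_nonneg (norm_nonneg _)]; exact hA x
  have hkey : (2 * Real.pi ^ 2) ^ Fintype.card I * pauliDensity I A = ∏ x, 2 * Real.pi ^ 2 * sigmaSU2 ‖A x‖ := by
    rw [pauliDensity_eq_prod I hA, Finset.prod_mul_distrib, Finset.prod_const, Finset.card_univ]
  have hlow : Real.exp (-(∑ x, (‖A x‖ ^ 2 / 3 + ‖A x‖ ^ 4))) = ∏ x, Real.exp (-(‖A x‖ ^ 2 / 3) - ‖A x‖ ^ 4) := by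
    rw [← Real.exp_sum, ← Finset.sum_neg_distrib]
    exact congrArg Real.exp (Finset.sum_congr rfl fun x _ => by ring)
  have hup : Real.exp (-(∑ x, (‖A x‖ ^ 2 / 3 - ‖A x‖ ^ 4))) = ∏ x, Real.exp (-(‖A x‖ ^ 2 / 3) + ‖A x‖ ^ 4) := by
    rw [← Real.exp_sum, ← Finset.sum_neg_distrib]
    exact congrArg Real.exp (Finset.sum_congr rfl fun x _ => by ring)
  rw [hkey, hlow, hup]
  exact ⟨Finset.prod_le_prod (fun x _ => (Real.exp_pos _).le) fun x _ => (exp_le_two_pi_sq_mul_sigmaSU2_le (hx x)).1,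
    Finset.prod_le_prod (fun x _ => by have := sigmaSU2_nonneg ‖A x‖; positivity)
      fun x _ => (exp_le_two_pi_sq_mul_sigmaSU2_le (hx x)).2⟩

end Summit.QuantumFields.YangMills.Theorems.AllWindowsColdBoxBoxHighLine.LaplaceSandwich

end
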